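import Summits.PneNP.PneNP.Theorems.ChebyshevTracialDesignWhitenedModeBound
import HarnessLib

/-!
# Cell pnp-psdrank, route `ChebyshevTracialDesign`: WHITENING DATA for matrix strategies — eigenbasis square roots, operator-norm layer
# energies of a whitened field, and the algebra of whitened harmonic layer data (toolkit for the well-conditioned cell, brick 87b)

Harmonic backbone of the crux `TracialDecayExp20` (stmt-PneNP-19878), brick 87b-I (prover g16; MEMO-19 §2(c)). The linear algebra behind
the whitening `A_U = S'X_US'ᵀ`, `B_M = T'Y_MT'ᵀ`, `C = SᵀT` of brick 87 (`…WhitenedModeBound`), in the tree's harmonic vocabulary (ladder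
layers `(Wᵀ)^{t−j}q_j` of `JohnsonHarmonics`/`JohnsonSpectrum`):
* §1 **`exists_whitening`** — for a symmetric `P` with `P ⪰ m·I`, `m > 0`: matrices `S`, `S'` with `S S' = I`, `S Sᵀ = P`, `S' P S'ᵀ = I` and
  `S' S'ᵀ ⪯ m⁻¹·I` (eigenbasis square root and its inverse, via brick 35b `exists_eigenbasis`).
* §2 `layer_sq_le_total` (one ladder layer's energy on the `t`-sets is at most the function's, Parseval `sum_sq_ladderSum`),
  **`layerEnergy_le`** — for a matrix field `A` on the `t`-subsets with entrywise harmonic layers `q` and `Σ_U A_UᵀA_U ⪯ α·I`, the layer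
  matrices `Q̃^{(j)}_U[a,b] = ((Wᵀ)^{t−j}q^{ab}_j)(U)` satisfy `Σ_{|U|=t} (Q̃^{(j)}_U)ᵀQ̃^{(j)}_U ⪯ α·I` — the OPERATOR-norm layer energy is at most
  the total energy (quadratic forms, Parseval coordinate by coordinate). This is the hypothesis `hA` of brick 87's `whitened_HSmode_sq_le`.
* §3 `conj_layerMatrix`, `layerData_conj` (conjugating layer matrices / ladder decompositions: `L·Q̃_U·Lᵀ` is the layer matrix of the data
  `Σ_{c,d} L[a,c]L[b,d]·q^{cd}`), `sum_range_succ_eq_add_Icc`, `layerRatio_nonneg` (`R_κ ≥ 0`), `sum_powersetCard_eq_of_layers` (slice mean of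
  a ladder sum = `C(n,t)·t!·p_0(∅)`: layers `j ≥ 1` have zero mean, `sum_powersetCard_ladder_eq_zero`).
Consumer: `…WellConditionedCell` (87b-II: well-conditioned pairs are virtually nonnegative at every dimension).
[cite: MacWilliamsSloane1977, Ch. 21 §6 Thm. 10 (PDF p. 516)] [cite: BrouwerHaemers2012, Thm. 4.9.1 (PDF p. 93)] [cite: Grigoriev2001, Lemma 1.4 (PDF p. 8)]
Stature: support/instrument (no defs, kernel lane). WHAT THIS IS NOT: no statement about the crux, nothing on psd rank of P_PM(K_n), no
P-vs-NP content. Supports stmt-PneNP-19878.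
-/

set_option linter.dupNamespace false -- `Summit.PneNP.PneNP.…`: summit = sub-problem (D-0017)

noncomputable section

namespace Summit.PneNP.PneNP.Theorems.ChebyshevTracialDesignWhiteningData

open Finset Matrix Literature.Barriers.PneNP Literature.Combinatorics.Optimization
open Literature.Combinatorics.AssociationSchemes Literature.Combinatorics.AssociationSchemes.JohnsonHarmonics
open Literature.Combinatorics.AssociationSchemes.JohnsonSpectrum
open Summit.PneNP.PneNP.Theorems.ChebyshevTracialDesignCommutative (posSemidef_conj one_sub_conj conj_mul_conj trace_conj)
open Summit.PneNP.PneNP.Theorems.ChebyshevTracialDesignProjectionNormalForm (exists_eigenbasis)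
open Summit.PneNP.PneNP.Theorems.ChebyshevTracialDesignWhitenedModeBound

variable {n r : ℕ}

/-! ### §1 Whitening data from a spectral lower bound -/

/-- **Whitening.** For a real symmetric `P` with `P − m·I ⪰ 0`, `m > 0`, there are `S`, `S'` with `S S' = I`, `S Sᵀ = P`, `S' P S'ᵀ = I` and
`m⁻¹·I − S' S'ᵀ ⪰ 0` (`S = O·diag(√x)`, `S' = diag(1/√x)·Oᵀ` in an eigenbasis `P = O·diag(x)·Oᵀ`, `x_i ≥ m`). [folklore] -/
theorem exists_whitening {P : Matrix (Fin r) (Fin r) ℝ} (hP : P.IsHermitian) {m : ℝ} (hm : 0 < m)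
    (hPm : (P - m • (1 : Matrix (Fin r) (Fin r) ℝ)).PosSemidef) :
    ∃ S S' : Matrix (Fin r) (Fin r) ℝ, S * S' = 1 ∧ S * Sᵀ = P ∧ S' * P * S'ᵀ = 1 ∧
      (m⁻¹ • (1 : Matrix (Fin r) (Fin r) ℝ) - S' * S'ᵀ).PosSemidef := by
  obtain ⟨O, x, hO, hPd⟩ := exists_eigenbasis hP
  have hO' : O * Oᵀ = 1 := mul_eq_one_comm.1 hO
  -- eigenvalues `≥ m`
  have hxm : ∀ i, m ≤ x i := fun i => by
    have h := posSemidef_conj hPm Oᵀ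
    have e : Oᵀ * (P - m • (1 : Matrix (Fin r) (Fin r) ℝ)) * Oᵀᵀ = diagonal fun i => x i - m := by
      rw [transpose_transpose, Matrix.mul_sub, Matrix.sub_mul, hPd, Matrix.mul_smul, Matrix.mul_one, Matrix.smul_mul, hO,
        Matrix.smul_one_eq_diagonal, ← diagonal_sub]
      congr 1
      calc Oᵀ * (O * diagonal x * Oᵀ) * O = (Oᵀ * O) * diagonal x * (Oᵀ * O) := by simp only [Matrix.mul_assoc]
        _ = diagonal x := by rw [hO, Matrix.one_mul, Matrix.mul_one]
    rw [e] at h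
    have := posSemidef_diagonal_iff.1 h i
    linarith
  have hxpos : ∀ i, 0 < x i := fun i => hm.trans_le (hxm i)
  have hsq : ∀ i, Real.sqrt (x i) * Real.sqrt (x i) = x i := fun i => Real.mul_self_sqrt (hxpos i).le
  have hsqpos : ∀ i, 0 < Real.sqrt (x i) := fun i => Real.sqrt_pos.2 (hxpos i)
  refine ⟨O * diagonal (fun i => Real.sqrt (x i)), diagonal (fun i => (Real.sqrt (x i))⁻¹) * Oᵀ, ?_, ?_, ?_, ?_⟩
  · -- `S S' = I`
    calc O * diagonal (fun i => Real.sqrt (x i)) * (diagonal (fun i => (Real.sqrt (x i))⁻¹) * Oᵀ)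
        = O * (diagonal (fun i => Real.sqrt (x i)) * diagonal (fun i => (Real.sqrt (x i))⁻¹)) * Oᵀ := by
          simp only [Matrix.mul_assoc]
      _ = 1 := by
          rw [diagonal_mul_diagonal, show (fun i => Real.sqrt (x i) * (Real.sqrt (x i))⁻¹) = fun _ => (1 : ℝ) from
            funext fun i => mul_inv_cancel₀ (hsqpos i).ne', diagonal_one, Matrix.mul_one, hO']
  · -- `S Sᵀ = P`
    rw [transpose_mul, diagonal_transpose, hPd]
    calc O * diagonal (fun i => Real.sqrt (x i)) * (diagonal (fun i => Real.sqrt (x i)) * Oᵀ)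
        = O * (diagonal (fun i => Real.sqrt (x i)) * diagonal (fun i => Real.sqrt (x i))) * Oᵀ := by
          simp only [Matrix.mul_assoc]
      _ = O * diagonal x * Oᵀ := by rw [diagonal_mul_diagonal, show (fun i => Real.sqrt (x i) * Real.sqrt (x i)) = x from funext hsq]
  · -- `S' P S'ᵀ = I`
    rw [hPd, transpose_mul, diagonal_transpose, transpose_transpose]
    calc diagonal (fun i => (Real.sqrt (x i))⁻¹) * Oᵀ * (O * diagonal x * Oᵀ) * (O * diagonal fun i => (Real.sqrt (x i))⁻¹)
        = diagonal (fun i => (Real.sqrt (x i))⁻¹) * ((Oᵀ * O) * diagonal x * (Oᵀ * O)) * diagonal (fun i => (Real.sqrt (x i))⁻¹) := by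
          simp only [Matrix.mul_assoc]
      _ = 1 := by
          rw [hO, Matrix.one_mul, Matrix.mul_one, diagonal_mul_diagonal, diagonal_mul_diagonal, ← diagonal_one]
          congr 1
          funext i
          rw [mul_comm ((Real.sqrt (x i))⁻¹) (x i), mul_assoc, ← mul_inv, hsq i, mul_inv_cancel₀ (hxpos i).ne']
  · -- `S' S'ᵀ = diag(1/x) ⪯ m⁻¹·I`
    rw [transpose_mul, diagonal_transpose, transpose_transpose]
    have e : diagonal (fun i => (Real.sqrt (x i))⁻¹) * Oᵀ * (O * diagonal fun i => (Real.sqrt (x i))⁻¹) =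
        diagonal fun i => (x i)⁻¹ := by
      calc _ = diagonal (fun i => (Real.sqrt (x i))⁻¹) * (Oᵀ * O) * diagonal (fun i => (Real.sqrt (x i))⁻¹) := by
            simp only [Matrix.mul_assoc]
        _ = _ := by
            rw [hO, Matrix.mul_one, diagonal_mul_diagonal]
            congr 1
            funext i
            rw [← mul_inv, hsq i]
    rw [e, Matrix.smul_one_eq_diagonal, diagonal_sub]
    exact PosSemidef.diagonal fun i => (by
      have := inv_anti₀ hm (hxm i)
      linarith : (0 : ℝ) ≤ m⁻¹ - (x i)⁻¹)

/-! ### §2 One ladder layer's energy is at most the total energy (scalar, then operator form) -/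

/-- **One layer ≤ total** on the `t`-sets: for harmonic data `q_j` (degree `j`) and `j ≤ t`,
`Σ_{|U|=t} ((Wᵀ)^{t−j}q_j)(U)² ≤ Σ_{|U|=t} (Σ_{j'≤t} (Wᵀ)^{t−j'}q_{j'})(U)²` (Parseval on the ladder decomposition).
[cite: MacWilliamsSloane1977, Ch. 21 §6 Thm. 10 (PDF p. 516)] -/
theorem layer_sq_le_total {t j : ℕ} (hjt : j ≤ t) (q : ℕ → Finset (Fin n) → ℝ) (hq : ∀ j', IsHarmonic j' (q j')) :
    ∑ U ∈ univ.powersetCard t, (up^[t - j] (q j)) U ^ 2 ≤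
      ∑ U ∈ univ.powersetCard t, (∑ j' ∈ range (t + 1), up^[t - j'] (q j')) U ^ 2 := by
  have hpar : ∑ j' ∈ range (t + 1), ip (up^[t - j'] (q j')) (up^[t - j'] (q j')) =
      ∑ U ∈ univ.powersetCard t, (∑ j' ∈ range (t + 1), up^[t - j'] (q j')) U ^ 2 := by
    rw [sum_congr rfl fun j' _ => ip_iterate_up_of_isHarmonic (hq j') (q j') (t - j'), ← sum_sq_ladderSum q hq]
  have hhom : IsHomog t (up^[t - j] (q j)) := by
    have h := isHomog_iterate_up (hq j).1 (t - j)
    rwa [Nat.add_sub_cancel' hjt] at h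
  have hlhs : ∑ U ∈ univ.powersetCard t, (up^[t - j] (q j)) U ^ 2 = ip (up^[t - j] (q j)) (up^[t - j] (q j)) := by
    rw [← sum_powersetCard_mul_of_isHomog _ hhom]
    exact sum_congr rfl fun U _ => sq _
  rw [hlhs, ← hpar]
  exact single_le_sum (f := fun j' => ip (up^[t - j'] (q j')) (up^[t - j'] (q j'))) (fun j' _ => ip_self_nonneg _)
    (mem_range.2 (by omega))

/-- **Operator-norm layer energy ≤ total energy.** For a matrix field `A` on the `t`-subsets with entrywise harmonic layers
`A_U[a,b] = Σ_{j'} ((Wᵀ)^{t−j'} q^{ab}_{j'})(U)` and `Σ_{|U|=t} A_UᵀA_U ⪯ α·I`, every layer matrix `Q̃^{(j)}_U[a,b] = ((Wᵀ)^{t−j}q^{ab}_j)(U)`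
satisfies `Σ_{|U|=t} (Q̃^{(j)}_U)ᵀ Q̃^{(j)}_U ⪯ α·I` (quadratic forms: `‖Q̃_U v‖²` summed over `U` is, coordinate by coordinate, one layer of
`‖A_U v‖²`). [cite: MacWilliamsSloane1977, Ch. 21 §6 Thm. 10 (PDF p. 516)] -/
theorem layerEnergy_le {t j : ℕ} (hjt : j ≤ t) (q : Fin r × Fin r → ℕ → Finset (Fin n) → ℝ)
    (hq : ∀ ab j', IsHarmonic j' (q ab j')) (A : Finset (Fin n) → Matrix (Fin r) (Fin r) ℝ)
    (hdec : ∀ ab, ∀ U ∈ univ.powersetCard t, A U ab.1 ab.2 = (∑ j' ∈ range (t + 1), up^[t - j'] (q ab j')) U) {α : ℝ}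
    (hA : (α • (1 : Matrix (Fin r) (Fin r) ℝ) - ∑ U ∈ univ.powersetCard t, (A U)ᵀ * A U).PosSemidef) :
    (α • (1 : Matrix (Fin r) (Fin r) ℝ) -
      ∑ U ∈ univ.powersetCard t, (Matrix.of fun a b => (up^[t - j] (q (a, b) j)) U)ᵀ *
        (Matrix.of fun a b => (up^[t - j] (q (a, b) j)) U)).PosSemidef := by
  set Qt : Finset (Fin n) → Matrix (Fin r) (Fin r) ℝ := fun U => Matrix.of fun a b => (up^[t - j] (q (a, b) j)) U with hQt
  -- Hermitian
  have hH : (α • (1 : Matrix (Fin r) (Fin r) ℝ) - ∑ U ∈ univ.powersetCard t, (Qt U)ᵀ * Qt U).IsHermitian := by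
    have h1 : (α • (1 : Matrix (Fin r) (Fin r) ℝ)).IsHermitian := by
      rw [IsHermitian, conjTranspose_smul, star_trivial, conjTranspose_one]
    refine h1.sub ?_
    rw [IsHermitian, conjTranspose_sum]
    refine sum_congr rfl fun U _ => ?_
    rw [conjTranspose_eq_transpose_of_trivial, transpose_mul, transpose_transpose]
  refine PosSemidef.of_dotProduct_mulVec_nonneg hH fun v => ?_
  rw [star_trivial, sub_mulVec, dotProduct_sub, smul_mulVec, one_mulVec, dotProduct_smul, smul_eq_mul]
  -- the quadratic form of `Σ_U PᵀP` at `v` is `Σ_U Σ_a (P_U v)_a²`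
  have hquad : ∀ (P : Finset (Fin n) → Matrix (Fin r) (Fin r) ℝ),
      v ⬝ᵥ ((∑ U ∈ univ.powersetCard t, (P U)ᵀ * P U) *ᵥ v) = ∑ U ∈ univ.powersetCard t, ∑ a, ((P U) *ᵥ v) a ^ 2 := by
    intro P
    rw [Matrix.sum_mulVec, dotProduct_sum]
    refine sum_congr rfl fun U _ => ?_
    rw [← mulVec_mulVec, dotProduct_mulVec, vecMul_transpose]
    simp only [dotProduct, sq]
  -- total energy bound from `hA`
  have htot : ∑ U ∈ univ.powersetCard t, ∑ a, ((A U) *ᵥ v) a ^ 2 ≤ α * (v ⬝ᵥ v) := by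
    have h := hA.dotProduct_mulVec_nonneg v
    rw [star_trivial, sub_mulVec, dotProduct_sub, smul_mulVec, one_mulVec, dotProduct_smul, smul_eq_mul, hquad A] at h
    linarith
  -- per coordinate `a`: `(Qt U v)_a` is the layer `j` of the ladder sum `(A U v)_a`
  have hcoord : ∀ a, ∑ U ∈ univ.powersetCard t, ((Qt U) *ᵥ v) a ^ 2 ≤ ∑ U ∈ univ.powersetCard t, ((A U) *ᵥ v) a ^ 2 := by
    intro a
    set qa : ℕ → Finset (Fin n) → ℝ := fun j' => ∑ b, v b • q (a, b) j' with hqa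
    have hqa' : ∀ j', IsHarmonic j' (qa j') := fun j' => IsHarmonic.sum _ fun b _ => (hq (a, b) j').smul _
    have e1 : ∀ U, ((Qt U) *ᵥ v) a = (up^[t - j] (qa j)) U := fun U => by
      simp only [hQt, mulVec, dotProduct, Matrix.of_apply, hqa, iterate_up_sum, iterate_up_smul, Finset.sum_apply, Pi.smul_apply,
        smul_eq_mul]
      exact sum_congr rfl fun b _ => mul_comm _ _
    have e2 : ∀ U ∈ univ.powersetCard t, ((A U) *ᵥ v) a = (∑ j' ∈ range (t + 1), up^[t - j'] (qa j')) U := fun U hU => by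
      rw [mulVec, dotProduct, Finset.sum_apply]
      calc ∑ b, A U a b * v b = ∑ b, ∑ j' ∈ range (t + 1), v b * (up^[t - j'] (q (a, b) j')) U := by
            refine sum_congr rfl fun b _ => ?_
            rw [hdec (a, b) U hU, Finset.sum_apply, mul_comm, mul_sum]
        _ = ∑ j' ∈ range (t + 1), ∑ b, v b * (up^[t - j'] (q (a, b) j')) U := sum_comm
        _ = _ := sum_congr rfl fun j' _ => by
            simp only [hqa, iterate_up_sum, iterate_up_smul, Finset.sum_apply, Pi.smul_apply, smul_eq_mul]
    calc ∑ U ∈ univ.powersetCard t, ((Qt U) *ᵥ v) a ^ 2 = ∑ U ∈ univ.powersetCard t, (up^[t - j] (qa j)) U ^ 2 :=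
          sum_congr rfl fun U _ => by rw [e1]
      _ ≤ ∑ U ∈ univ.powersetCard t, (∑ j' ∈ range (t + 1), up^[t - j'] (qa j')) U ^ 2 := layer_sq_le_total hjt qa hqa'
      _ = ∑ U ∈ univ.powersetCard t, ((A U) *ᵥ v) a ^ 2 := sum_congr rfl fun U hU => by rw [e2 U hU]
  have hsum : ∑ U ∈ univ.powersetCard t, ∑ a, ((Qt U) *ᵥ v) a ^ 2 ≤ ∑ U ∈ univ.powersetCard t, ∑ a, ((A U) *ᵥ v) a ^ 2 := by
    rw [sum_comm, sum_comm (s := univ.powersetCard t)]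
    exact sum_le_sum fun a _ => hcoord a
  rw [hquad Qt]
  linarith

/-! ### §3 Algebra of whitened layer data -/

/-- **Conjugating a layer matrix.** `L·Q̃_U·Lᵀ` is the layer matrix of the combined harmonic data `Σ_{c,d} L[a,c]L[b,d]·P^{cd}`.
[cite: MacWilliamsSloane1977, Ch. 21 §6 Thm. 10 (PDF p. 516)] -/
theorem conj_layerMatrix {m : ℕ} (L : Matrix (Fin r) (Fin r) ℝ) (P : Fin r → Fin r → Finset (Fin n) → ℝ) (U : Finset (Fin n)) :
    L * (Matrix.of fun a b => (up^[m] (P a b)) U) * Lᵀ =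
      Matrix.of fun a b => (up^[m] (∑ c, ∑ d, (L a c * L b d) • P c d)) U := by
  ext a b
  simp only [Matrix.of_apply, iterate_up_sum, iterate_up_smul, Finset.sum_apply, Pi.smul_apply, smul_eq_mul, Matrix.mul_apply,
    Matrix.transpose_apply, sum_mul]
  rw [Finset.sum_comm]
  exact sum_congr rfl fun c _ => sum_congr rfl fun d _ => by ring

/-- **Conjugating a ladder decomposition.** If `Xf_U[a,b] = Σ_j ((Wᵀ)^{t−j}p^{ab}_j)(U)` on `s`, then `(L Xf_U Lᵀ)[a,b] = Σ_j ((Wᵀ)^{t−j}q^{ab}_j)(U)`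
with `q^{ab}_j = Σ_{c,d} L[a,c]L[b,d]·p^{cd}_j`. [cite: MacWilliamsSloane1977, Ch. 21 §6 Thm. 10 (PDF p. 516)] -/
theorem layerData_conj {t : ℕ} (s : Finset (Finset (Fin n))) (L : Matrix (Fin r) (Fin r) ℝ)
    (Xf : Finset (Fin n) → Matrix (Fin r) (Fin r) ℝ) (p : Fin r × Fin r → ℕ → Finset (Fin n) → ℝ)
    (hdec : ∀ ab, ∀ U ∈ s, Xf U ab.1 ab.2 = (∑ j ∈ range (t + 1), up^[t - j] (p ab j)) U) :
    ∀ ab : Fin r × Fin r, ∀ U ∈ s, (L * Xf U * Lᵀ) ab.1 ab.2 =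
      (∑ j ∈ range (t + 1), up^[t - j] (∑ c, ∑ d, (L ab.1 c * L ab.2 d) • p (c, d) j)) U := by
  intro ab U hU
  have hX : Xf U = ∑ j ∈ range (t + 1), Matrix.of fun a b => (up^[t - j] (p (a, b) j)) U := by
    ext a b
    rw [hdec (a, b) U hU, Finset.sum_apply, Matrix.sum_apply]
    rfl
  rw [hX, Finset.mul_sum, Finset.sum_mul, Matrix.sum_apply, Finset.sum_apply]
  refine sum_congr rfl fun j _ => ?_
  rw [conj_layerMatrix L (fun a b => p (a, b) j) U, Matrix.of_apply]

/-- `Σ_{κ < m+1} f(κ) = f(0) + Σ_{1 ≤ κ ≤ m} f(κ)`. [folklore] -/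
theorem sum_range_succ_eq_add_Icc (m : ℕ) (f : ℕ → ℝ) : ∑ κ ∈ range (m + 1), f κ = f 0 + ∑ κ ∈ Icc 1 m, f κ := by
  have hs : range (m + 1) = insert 0 (Icc 1 m) := by ext κ; simp only [mem_range, mem_insert, mem_Icc]; omega
  rw [hs, sum_insert (by simp)]

/-- The re-weighting factors `R_κ` are nonnegative (`κ ≤ c'`, `2t ≤ n`). [cite: Grigoriev2001, Lemma 1.4 (PDF p. 8)] -/
theorem layerRatio_nonneg {c' κ : ℕ} (ht : 2 * (2 * c' + 1) ≤ n) (hκ : κ ≤ c') :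
    0 ≤ ∏ i ∈ range κ, (((2 * c' + 1 : ℝ) - 2 * i) * ((n : ℝ) - 2 * c' - 1 - 2 * i) /
      (((2 * c' : ℝ) - 2 * i) * ((n : ℝ) - 2 * c' - 2 - 2 * i))) := by
  refine prod_nonneg fun i hi => ?_
  have hi' := mem_range.1 hi
  have h1 : (2 * i : ℝ) + 2 ≤ 2 * c' := by exact_mod_cast (show 2 * i + 2 ≤ 2 * c' by omega)
  have h2 : (2 * c' : ℝ) + 2 + 2 * i + 2 ≤ n := by exact_mod_cast (show 2 * c' + 2 + 2 * i + 2 ≤ n by omega)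
  have ha : 0 ≤ (2 * c' + 1 : ℝ) - 2 * i := by linarith
  have hb : 0 ≤ (n : ℝ) - 2 * c' - 1 - 2 * i := by linarith
  have hc : 0 ≤ (2 * c' : ℝ) - 2 * i := by linarith
  have hd : 0 ≤ (n : ℝ) - 2 * c' - 2 - 2 * i := by linarith
  positivity

/-- **Slice mean of a ladder sum**: if `Xf_U[a,b] = Σ_j ((Wᵀ)^{t−j}p^{ab}_j)(U)` on the `t`-sets, then
`Σ_{|U|=t} Xf_U[a,b] = C(n,t)·t!·p^{ab}_0(∅)` (layers `j ≥ 1` have zero mean). [cite: MacWilliamsSloane1977, Ch. 21 §6 Thm. 10 (PDF p. 516)] -/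
theorem sum_powersetCard_eq_of_layers {t : ℕ} (Xf : Finset (Fin n) → Matrix (Fin r) (Fin r) ℝ)
    (p : Fin r × Fin r → ℕ → Finset (Fin n) → ℝ) (hp : ∀ ab j, IsHarmonic j (p ab j))
    (hdec : ∀ ab, ∀ U ∈ univ.powersetCard t, Xf U ab.1 ab.2 = (∑ j ∈ range (t + 1), up^[t - j] (p ab j)) U) (ab : Fin r × Fin r) :
    ∑ U ∈ univ.powersetCard t, Xf U ab.1 ab.2 = (n.choose t : ℝ) * ((t.factorial : ℝ) * p ab 0 ∅) := by
  calc ∑ U ∈ univ.powersetCard t, Xf U ab.1 ab.2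
      = ∑ U ∈ univ.powersetCard t, ∑ j ∈ range (t + 1), (up^[t - j] (p ab j)) U :=
        sum_congr rfl fun U hU => by rw [hdec ab U hU, Finset.sum_apply]
    _ = ∑ j ∈ range (t + 1), ∑ U ∈ univ.powersetCard t, (up^[t - j] (p ab j)) U := sum_comm
    _ = ∑ U ∈ univ.powersetCard t, (up^[t - 0] (p ab 0)) U := by
        rw [sum_range_succ_eq_add_Icc, add_eq_left]
        exact sum_eq_zero fun j hj => sum_powersetCard_ladder_eq_zero (mem_Icc.1 hj).1 (mem_Icc.1 hj).2 (hp ab j)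
    _ = ∑ U ∈ univ.powersetCard t, (t.factorial : ℝ) * p ab 0 ∅ :=
        sum_congr rfl fun U hU => by rw [Nat.sub_zero, iterate_up_apply_of_degree_zero (hp ab 0).1 (mem_powersetCard.1 hU).2]
    _ = (n.choose t : ℝ) * ((t.factorial : ℝ) * p ab 0 ∅) := by rw [sum_const, card_powersetCard, card_univ, Fintype.card_fin, nsmul_eq_mul]

end Summit.PneNP.PneNP.Theorems.ChebyshevTracialDesignWhiteningData

end
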